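import Summits.QuantumFields.BalabanUV.T4Continuum.Support.RegionGaugeTwoZone
import Summits.QuantumFields.BalabanUV.T4Continuum.Support.CovariantBlockAveraging
import Literature.MathematicalPhysics.QuantumFieldTheory.Balaban1983to89.B5G183FreeRowSum

/-!
# T⁴ programme, spine node NE2 (U1a), sub-row Δ1 «NE2⁰-Dirichlet» — THE TWO-ZONE SLICE INEQUALITY IS EQUIVALENT (constants `d, a` only)
# TO THE SINGLE-ZONE SLICE INEQUALITY OF THE INNER REGION: the η-mass collar trivialises `∂Ω₀` but NOT the interface `∂Ω₁`

NE2 formalisation swarm `b2b-balaban-t4-ne2-formalise-*`, leaf 07 (gen 6), supplier item «Δ1-COERC-2Z» (owner ruling R25 (c), CLAIM journal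
2026-08-20 l.17403), file 2 of 2.  File 1 (`Support/RegionGaugeTwoZone`) typed the two-zone `U = 1` region vector operator `regionDeltaA₂ n M a a′ S₀ S₁`
(Ω₁ ⊂ Ω₀ on the STAR bonds of Ω₀; gauge functions supported in Ω₁; unit-block averaging mass + (3.16)'s `j = 0` η-scale collar mass) and
reduced its bound to ONE displayed inequality `SliceCoercive₂ := SliceCoercive (curlR S₀) gradR₂ (GOm S₁) (QOm S₁) Qv₂ a c`.

THIS FILE PROVES, in the kernel, that this displayed inequality is EQUIVALENT — with constants depending on `d` and `a` only, uniformly in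
`n = η⁻¹`, `M`, `S₀`, `S₁` — to gen 5's SINGLE-zone displayed inequality of the INNER region,
`SliceCoercive (curlR S₁) (gradR S₁) (GOm S₁) (QOm S₁) (avgR S₁) (a·n^d) c` (`Support/RegionGaugeFixedVector`, the located open estimate
G-ne2leaf07g5-1 of `t4/T4-EST-NE2-D1-COERC.md` §6):

 * §1 elementary torus bounds (no Fourier): `nsq_shiftM` (shifts are isometries), **`nsq_fdiff_le`** `‖∇_νB‖² ≤ 4|c|²‖B‖²`,
   **`re_form_Lap_le`** `Re⟨B, ΔB⟩ ≤ 4dn²‖B‖²`, **`nsq_curl_le`** `½‖Curl B‖² ≤ 4dn²‖B‖²` (through «∂*∂ = Δ − ∂∂*», `curl_adjoint_curl`),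
   **`nsq_QvOp_mulVec_le`** `n^d‖QB‖² ≤ ‖B‖²` (this lineage's `opNorm_QvOp_le`), and `nsq_add_ge` (`‖u+v‖² ≥ (ε/2)‖u‖² − ε‖v‖²`, `0 ≤ ε ≤ 1`).
 * §2 the INNER / COLLAR split of a field on the star bonds of Ω₀ read on the torus: `ιA = ι(inner A) + ι_collar(selC A)`, disjoint supports
   (`nsq_split`), the divergence on Ω₁ reads only the inner part (`gradR₂_conjTranspose_mulVec_eq_inner`), and the embedding of an inner field
   (zero on the collar: `selC_extend` / `inner_extend` / `ext_extend`).
 * §3 **`sliceCoercive_inner_of_twoZone (hsub) : SliceCoercive₂ c → SliceCoercive(S₁) c`** (SAME constant): zero-extend an inner slice field —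
   same torus curl, same averages, no collar mass, and the two-zone slice condition only reads star(S₁) bonds.
 * §4 **`sliceCoercive_twoZone_of_inner (hsub) (0 < a) : SliceCoercive(S₁) c → SliceCoercive₂ (min (a·c/(4(4d+a))) (a/2))`**: split
   `A = A_in + A_col`; the collar part's curl and averages are `≤ (4d n² + 1)·‖A_col‖²`, paid by the collar mass `a n²‖A_col‖²` after weighting the
   inner inequality by `ε = a/(2(4d+a))`.
 * §5 hence **`opNorm_inv_regionDeltaA₂_le_of_inner`**: the single-zone slice constant of `S₁` ALONE bounds `‖G₂(Ω₀)‖`, uniformly in `S₀ ⊇ S₁`.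

VERDICT (structural, kernel-checked; answers R25 (c) «coercivity ⟸ ONE displayed slice inequality whose collar part is trivial»): the collar part IS
trivial, but what remains is EXACTLY the single-zone inequality of Ω₁ — typing the two-zone model does not make the located open estimate easier
(nor harder): it is intrinsic to the interface between the unit-averaged zone and its massive / Dirichlet exterior.  ([Balaban1985BackgroundPropagators]
(3.16) has a GRADED transition Λ₀, Λ₁, …, Λ_k with `L^j`-block averagings, not one sharp interface; nothing printed is objected to.)

HONEST FRAMING (T4-DAG p. 1).  Model level (`U = 1`, two zones, ONE sharp interface, finite torus, operator norm); an EQUIVALENCE between two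
DISPLAYED inequalities + elementary bounds, NOT a proof of either; constants ours; NOT [B9] (3.16)/(3.23)–(3.27) as printed; NE2 (U1a) NOT proved;
spine 0/9 unchanged; NOT infinite volume / mass gap / Clay / summit progress.  HONEST DEPENDENCY: continuum YM on T⁴ ⇐ BetaPertH ∧ nine spine
estimates (0/9 proved); BetaPertH ⇐ (D1) ∧ (D4) ∧ CAP+tail; G-an2-4 gates asym, D1 and NE2/3/4.  No `sorry`.
-/

noncomputable section

open scoped BigOperators ComplexConjugate Matrix Matrix.Norms.L2Operator
open Finset

namespace Summit.QuantumFields.BalabanUV.T4Continuum.RegionGaugeTwoZoneTransfer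

open Literature.MathematicalPhysics.QuantumFieldTheory.Balaban1983to89.B5Prop11Plancherel (Tor fine unitVec shiftM fdiff)
open Literature.MathematicalPhysics.QuantumFieldTheory.Balaban1983to89.B5Prop11Lower (nsq nsq_nonneg Lap star_dotProduct_self)
open Literature.MathematicalPhysics.QuantumFieldTheory.Balaban1983to89.B5Action121 (LapS LapV GradOp CurlOp curl_adjoint_curl Lap_eq_LapV
  star_mulVec_dotProduct)
open Literature.MathematicalPhysics.QuantumFieldTheory.Balaban1983to89.B5Block118 (QsOp QvOp)
open Literature.MathematicalPhysics.QuantumFieldTheory.Balaban1983to89.B5G183FreeRowSum (shiftM_mulVec)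
open Summit.QuantumFields.BalabanUV.T4Continuum
open Summit.QuantumFields.BalabanUV.T4Continuum.SubtypeCompression (Coercive ext ext_apply_of ext_apply_of_not nsq_ext toBlock_conjTranspose)
open Summit.QuantumFields.BalabanUV.T4Continuum.ScalarBlockPoincare (nsq_smul nsq_add_le)
open Summit.QuantumFields.BalabanUV.T4Continuum.ScalarAveragedPropagator (gammaPs gammaPs_pos)
open Summit.QuantumFields.BalabanUV.T4Continuum.RegionGaugeProjection (gaugeR)
open Summit.QuantumFields.BalabanUV.T4Continuum.RegionGaugeSlice (SliceCoercive form_gram re_form_le_opNorm)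
open Summit.QuantumFields.BalabanUV.T4Continuum.RegionScalarCompression (QOm GOm)
open Summit.QuantumFields.BalabanUV.T4Continuum.RegionGaugeFixedVector (starReg curlR gradR avgR GradOp_apply_eq_zero_of_not_star)
open Summit.QuantumFields.BalabanUV.T4Continuum.RegionGaugeFixedVectorFlat (avgR_mulVec)
open Summit.QuantumFields.BalabanUV.T4Continuum.RegionGaugeSliceTorus (curlR_mulVec gradR_conjTranspose_mulVec)
open Summit.QuantumFields.BalabanUV.T4Continuum.RegionGaugeTwoZone (collar selC selC_mulVec gradR₂ Qv₂ regionDeltaA₂ nsq_Qv₂_mulVec inner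
  starReg_mono ext_eq_ext_inner opNorm_inv_regionDeltaA₂_le_of_slice)
open Summit.QuantumFields.BalabanUV.T4Continuum.CovariantBlockAveraging (opNorm_QvOp_le)
open Summit.QuantumFields.BalabanUV.Beta.GAN24.DirichletBoxCompression (toBlock_mulVec')
open Summit.QuantumFields.BalabanUV.Beta.GAN24.DirichletBoxTrace (blockReg)

variable {d : ℕ}

/-! ## §1 Elementary torus bounds -/

section TorusBounds

variable (N : Fin d → ℕ) [hN : ∀ μ, NeZero (N μ)]

/-- **shifts are isometries**: `‖S_ν B‖² = ‖B‖²`. [folklore] -/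
theorem nsq_shiftM (ν : Fin d) (B : Tor N × Fin d → ℂ) : nsq (shiftM N ν *ᵥ B) = nsq B := by
  unfold nsq
  simp only [shiftM_mulVec]
  exact Fintype.sum_equiv ((Equiv.addRight (unitVec N ν)).prodCongr (Equiv.refl (Fin d))) _ _ (fun i => rfl)

omit hN in
/-- `‖−v‖² = ‖v‖²`. [folklore] -/
theorem nsq_neg {m : Type*} [Fintype m] (v : m → ℂ) : nsq (-v) = nsq v := by
  simp [nsq]

omit hN in
/-- `‖u − v‖² ≤ 2‖u‖² + 2‖v‖²`. [folklore] -/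
theorem nsq_sub_le {m : Type*} [Fintype m] (u v : m → ℂ) : nsq (u - v) ≤ 2 * nsq u + 2 * nsq v := by
  rw [sub_eq_add_neg, ← nsq_neg v]; exact nsq_add_le _ _

omit hN in
/-- **`‖u + v‖² ≥ (ε/2)‖u‖² − ε‖v‖²`** for `0 ≤ ε ≤ 1`. [folklore] -/
theorem nsq_add_ge {m : Type*} [Fintype m] (u v : m → ℂ) {ε : ℝ} (h0 : 0 ≤ ε) (h1 : ε ≤ 1) :
    ε / 2 * nsq u - ε * nsq v ≤ nsq (u + v) := by
  have h : nsq u ≤ 2 * nsq (u + v) + 2 * nsq v := by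
    have := nsq_sub_le (u + v) v; rwa [add_sub_cancel_right] at this
  have hp := nsq_nonneg (u + v)
  nlinarith

/-- **`‖∇_ν B‖² ≤ 4|c|²‖B‖²**. [folklore] -/
theorem nsq_fdiff_le (c : ℂ) (ν : Fin d) (B : Tor N × Fin d → ℂ) : nsq (fdiff N c ν *ᵥ B) ≤ 4 * ‖c‖ ^ 2 * nsq B := by
  rw [fdiff, Matrix.smul_mulVec, nsq_smul, Matrix.sub_mulVec, Matrix.one_mulVec]
  have h := nsq_sub_le (shiftM N ν *ᵥ B) B
  rw [nsq_shiftM] at h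
  have hc : 0 ≤ ‖c‖ ^ 2 := sq_nonneg _
  nlinarith

end TorusBounds

section Torus

variable (n : ℕ) [NeZero n] (M : Fin d → ℕ) [hM : ∀ μ, NeZero (M μ)]

/-- `Re⟨B, ΔB⟩ = Σ_ν ‖∇_νB‖²`. [cite: Balaban1984PropagatorsI, (1.21) p.21 (shape)] [folklore] -/
theorem re_form_Lap_eq (B : Tor (fine n M) × Fin d → ℂ) :
    (star B ⬝ᵥ (Lap n M *ᵥ B)).re = ∑ ν, nsq (fdiff (fine n M) (n : ℂ) ν *ᵥ B) := by
  rw [Lap, Matrix.sum_mulVec, dotProduct_sum, Complex.re_sum]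
  exact Finset.sum_congr rfl fun ν _ => by rw [form_gram, Complex.ofReal_re]

/-- **`Re⟨B, ΔB⟩ ≤ 4dn²‖B‖²**. [folklore] -/
theorem re_form_Lap_le (B : Tor (fine n M) × Fin d → ℂ) :
    (star B ⬝ᵥ (Lap n M *ᵥ B)).re ≤ 4 * d * (n : ℝ) ^ 2 * nsq B := by
  rw [re_form_Lap_eq]
  calc ∑ ν, nsq (fdiff (fine n M) (n : ℂ) ν *ᵥ B) ≤ ∑ _ν : Fin d, 4 * (n : ℝ) ^ 2 * nsq B :=
        Finset.sum_le_sum fun ν _ => by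
          have h := nsq_fdiff_le (fine n M) (n : ℂ) ν B
          rwa [Complex.norm_natCast] at h
    _ = 4 * d * (n : ℝ) ^ 2 * nsq B := by rw [Finset.sum_const, Finset.card_univ, Fintype.card_fin, nsmul_eq_mul]; ring

/-- **THE CURL IS BOUNDED BY THE ROUGH FORM**: `½‖Curl B‖² = Re⟨B, ΔB⟩ − ‖∂ᴴB‖² ≤ 4dn²‖B‖²` («∂*∂ = Δ − ∂∂*»).
[cite: Balaban1984PropagatorsI, (1.21) p.21 (shape)] [folklore] -/
theorem nsq_curl_le (B : Tor (fine n M) × Fin d → ℂ) :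
    nsq ((((Real.sqrt 2)⁻¹ : ℝ) : ℂ) • (CurlOp (fine n M) (n : ℂ) *ᵥ B)) ≤ 4 * d * (n : ℝ) ^ 2 * nsq B := by
  have hs : ‖((((Real.sqrt 2)⁻¹ : ℝ) : ℂ))‖ ^ 2 = 1 / 2 := by
    rw [Complex.norm_real, Real.norm_of_nonneg (by positivity), inv_pow, Real.sq_sqrt (by norm_num : (0:ℝ) ≤ 2), one_div]
  rw [nsq_smul, hs]
  -- `‖Curl B‖² = ⟨B, CurlᴴCurl B⟩ = 2·(⟨B, ΔB⟩ − ‖∂ᴴB‖²)`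
  have h1 : ((nsq (CurlOp (fine n M) (n : ℂ) *ᵥ B) : ℝ) : ℂ)
      = (2 : ℂ) • (star B ⬝ᵥ (Lap n M *ᵥ B) - star B ⬝ᵥ ((GradOp (fine n M) (n : ℂ) * (GradOp (fine n M) (n : ℂ))ᴴ) *ᵥ B)) := by
    rw [← form_gram (CurlOp (fine n M) (n : ℂ)) B, curl_adjoint_curl, ← Lap_eq_LapV, Matrix.smul_mulVec, dotProduct_smul,
      Matrix.sub_mulVec, dotProduct_sub]
  have h2 : star B ⬝ᵥ ((GradOp (fine n M) (n : ℂ) * (GradOp (fine n M) (n : ℂ))ᴴ) *ᵥ B)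
      = ((nsq ((GradOp (fine n M) (n : ℂ))ᴴ *ᵥ B) : ℝ) : ℂ) := by
    rw [← Matrix.mulVec_mulVec, ← star_dotProduct_self, star_mulVec_dotProduct, Matrix.conjTranspose_conjTranspose]
  rw [h2] at h1
  have h3 : nsq (CurlOp (fine n M) (n : ℂ) *ᵥ B)
      = 2 * ((star B ⬝ᵥ (Lap n M *ᵥ B)).re - nsq ((GradOp (fine n M) (n : ℂ))ᴴ *ᵥ B)) := by
    have := congrArg Complex.re h1
    simp only [Complex.ofReal_re, smul_eq_mul, Complex.mul_re, Complex.sub_re, Complex.sub_im, Complex.ofReal_im] at this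
    norm_num at this
    linarith
  have h4 := re_form_Lap_le n M B
  have h5 := nsq_nonneg ((GradOp (fine n M) (n : ℂ))ᴴ *ᵥ B)
  rw [h3]
  nlinarith

/-- **`n^d‖QB‖² ≤ ‖B‖²** for Bałaban's vector block averaging (`‖Q‖² ≤ n^{−d}`, this lineage's `opNorm_QvOp_le`).
[cite: Balaban1984PropagatorsI, (1.18) p.20 (shape)] [folklore] -/
theorem nsq_QvOp_mulVec_le (B : Tor (fine n M) × Fin d → ℂ) : (n : ℝ) ^ d * nsq (QvOp n M *ᵥ B) ≤ nsq B := by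
  have hn : (0 : ℝ) < (n : ℝ) ^ d := pow_pos (by exact_mod_cast Nat.pos_of_ne_zero (NeZero.ne n)) d
  -- `‖QB‖² = Re⟨B, QᴴQ B⟩ ≤ ‖QᴴQ‖·‖B‖² = ‖Q‖²‖B‖² ≤ n^{−d}‖B‖²`
  have h1 : nsq (QvOp n M *ᵥ B) = (star ((((QvOp n M)ᴴ * QvOp n M)) *ᵥ B) ⬝ᵥ B).re := by
    have e := form_gram (QvOp n M) B
    have hH : ((QvOp n M)ᴴ * QvOp n M).IsHermitian := Matrix.isHermitian_conjTranspose_mul_self _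
    rw [star_mulVec_dotProduct, hH.eq, e, Complex.ofReal_re]
  have h2 : (star (((QvOp n M)ᴴ * QvOp n M) *ᵥ B) ⬝ᵥ B).re ≤ ‖(QvOp n M)ᴴ * QvOp n M‖ * nsq B := re_form_le_opNorm _ _
  have h3 : ‖(QvOp n M)ᴴ * QvOp n M‖ ≤ ((n : ℝ) ^ d)⁻¹ := by
    rw [Matrix.l2_opNorm_conjTranspose_mul_self]
    have hq := opNorm_QvOp_le n M
    have h0 : 0 ≤ ‖QvOp n M‖ := norm_nonneg _
    calc ‖QvOp n M‖ * ‖QvOp n M‖ ≤ (Real.sqrt ((n : ℝ) ^ d))⁻¹ * (Real.sqrt ((n : ℝ) ^ d))⁻¹ :=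
          mul_le_mul hq hq h0 (le_trans h0 hq)
      _ = ((n : ℝ) ^ d)⁻¹ := by rw [← mul_inv, Real.mul_self_sqrt hn.le]
  have h4 : nsq (QvOp n M *ᵥ B) ≤ ((n : ℝ) ^ d)⁻¹ * nsq B :=
    (h1.le.trans h2).trans (mul_le_mul_of_nonneg_right h3 (nsq_nonneg _))
  calc (n : ℝ) ^ d * nsq (QvOp n M *ᵥ B) ≤ (n : ℝ) ^ d * (((n : ℝ) ^ d)⁻¹ * nsq B) := mul_le_mul_of_nonneg_left h4 hn.le
    _ = nsq B := by rw [← mul_assoc, mul_inv_cancel₀ hn.ne', one_mul]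

end Torus

/-! ## §2 The inner / collar split of a field on the star bonds of `Ω₀`, read on the torus -/

section Split

variable (n : ℕ) [NeZero n] (M : Fin d → ℕ) [hM : ∀ μ, NeZero (M μ)] (a a' : ℝ) (S₀ S₁ : Tor M → Prop)
  [DecidablePred S₀] [DecidablePred S₁]

/-- **THE SPLIT**: `ιA = ι(inner A) + ι_collar(selC A)` on the torus. [folklore] -/
theorem ext_split (hsub : ∀ y, S₁ y → S₀ y) (A : {b // starReg n M S₀ b} → ℂ) :
    ext (starReg n M S₀) A
      = ext (starReg n M S₁) (inner n M S₀ S₁ hsub A) + ext (collar n M S₀ S₁) (selC n M S₀ S₁ *ᵥ A) := by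
  funext b
  rw [Pi.add_apply, selC_mulVec]
  by_cases h1 : starReg n M S₁ b
  · have hc : ¬ collar n M S₀ S₁ b := fun h => h.2 h1
    rw [ext_apply_of _ _ ⟨b, h1⟩, ext_apply_of_not _ _ hc, add_zero]
    exact ext_apply_of _ _ ⟨b, starReg_mono n M S₀ S₁ hsub h1⟩
  · rw [ext_apply_of_not _ _ h1, zero_add]
    by_cases h0 : starReg n M S₀ b
    · rw [ext_apply_of _ _ ⟨b, h0⟩]
      exact (ext_apply_of (collar n M S₀ S₁) (fun c => A ⟨c.1, c.2.1⟩) ⟨b, h0, h1⟩).symm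
    · have hc : ¬ collar n M S₀ S₁ b := fun h => h0 h.1
      rw [ext_apply_of_not _ _ h0, ext_apply_of_not _ _ hc]

/-- **DISJOINT SUPPORTS**: `‖A‖² = ‖inner A‖² + ‖selC A‖²`. [folklore] -/
theorem nsq_split (hsub : ∀ y, S₁ y → S₀ y) (A : {b // starReg n M S₀ b} → ℂ) :
    nsq A = nsq (inner n M S₀ S₁ hsub A) + nsq (selC n M S₀ S₁ *ᵥ A) := by
  rw [← nsq_ext (starReg n M S₀) A, ← nsq_ext (starReg n M S₁) (inner n M S₀ S₁ hsub A),
    ← nsq_ext (collar n M S₀ S₁) (selC n M S₀ S₁ *ᵥ A)]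
  unfold nsq
  rw [← Finset.sum_add_distrib]
  refine Finset.sum_congr rfl fun b _ => ?_
  have e := congrFun (ext_split n M S₀ S₁ hsub A) b
  by_cases h1 : starReg n M S₁ b
  · have hc : ¬ collar n M S₀ S₁ b := fun h => h.2 h1
    rw [e, Pi.add_apply, ext_apply_of_not (collar n M S₀ S₁) _ hc, add_zero, norm_zero, zero_pow two_ne_zero, add_zero]
  · rw [e, Pi.add_apply, ext_apply_of_not (starReg n M S₁) _ h1, zero_add, norm_zero, zero_pow two_ne_zero, zero_add]

/-- the divergence on `Ω₁` of a field supported on the collar vanishes. [folklore] -/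
theorem div_ext_collar_eq_zero (w : {b // collar n M S₀ S₁ b} → ℂ) (x : {x // blockReg n M S₁ x}) :
    ((GradOp (fine n M) (n : ℂ))ᴴ *ᵥ ext (collar n M S₀ S₁) w) x = 0 := by
  rw [Matrix.mulVec, dotProduct]
  refine Finset.sum_eq_zero fun b _ => ?_
  by_cases hb : collar n M S₀ S₁ b
  · rw [Matrix.conjTranspose_apply, GradOp_apply_eq_zero_of_not_star n M S₁ hb.2 x.2, star_zero, zero_mul]
  · rw [ext_apply_of_not _ _ hb, mul_zero]

/-- the two-zone divergence reads on the torus. [folklore] -/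
theorem gradR₂_conjTranspose_mulVec (A : {b // starReg n M S₀ b} → ℂ) :
    (gradR₂ n M S₀ S₁)ᴴ *ᵥ A = fun x : {x // blockReg n M S₁ x} => ((GradOp (fine n M) (n : ℂ))ᴴ *ᵥ ext (starReg n M S₀) A) x := by
  rw [gradR₂, toBlock_conjTranspose, toBlock_mulVec']

/-- **THE DIVERGENCE ON `Ω₁` READS ONLY THE INNER PART**: `∂₂ᴴA = ∂_{Ω₁}ᴴ(inner A)`. [folklore] -/
theorem gradR₂_conjTranspose_mulVec_eq_inner (hsub : ∀ y, S₁ y → S₀ y) (A : {b // starReg n M S₀ b} → ℂ) :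
    (gradR₂ n M S₀ S₁)ᴴ *ᵥ A = (gradR n M S₁)ᴴ *ᵥ inner n M S₀ S₁ hsub A := by
  rw [gradR₂_conjTranspose_mulVec, gradR_conjTranspose_mulVec, ext_split n M S₀ S₁ hsub A]
  funext x
  rw [Matrix.mulVec_add, Pi.add_apply, div_ext_collar_eq_zero, add_zero]

/-- the embedded field has no collar components. [folklore] -/
theorem selC_extend (A₁ : {b // starReg n M S₁ b} → ℂ) : selC n M S₀ S₁ *ᵥ (fun b : {b // starReg n M S₀ b} => ext (starReg n M S₁) A₁ b.1) = 0 := by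
  rw [selC_mulVec]; funext c; exact ext_apply_of_not _ _ c.2.2

omit [DecidablePred S₀] in
/-- … and its inner part is the original field. [folklore] -/
theorem inner_extend (hsub : ∀ y, S₁ y → S₀ y) (A₁ : {b // starReg n M S₁ b} → ℂ) :
    inner n M S₀ S₁ hsub (fun b : {b // starReg n M S₀ b} => ext (starReg n M S₁) A₁ b.1) = A₁ := by
  funext b; exact ext_apply_of _ _ b

/-- … so its zero-extension is the zero-extension of the original field. [folklore] -/
theorem ext_extend (hsub : ∀ y, S₁ y → S₀ y) (A₁ : {b // starReg n M S₁ b} → ℂ) :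
    ext (starReg n M S₀) (fun b : {b // starReg n M S₀ b} => ext (starReg n M S₁) A₁ b.1) = ext (starReg n M S₁) A₁ := by
  rw [ext_eq_ext_inner n M S₀ S₁ hsub _ (selC_extend n M S₀ S₁ A₁), inner_extend]

/-! ## §3 The two-zone inequality implies the single-zone inequality of the inner region (same constant) -/

/-- **`SliceCoercive₂(S₀,S₁,c) ⟹ SliceCoercive(S₁,c)`**: test the two-zone inequality on the zero-extension of an inner slice field — same torus
curl, same block averages, no collar mass; the two-zone slice condition only reads the star bonds of `Ω₁`. [folklore] -/
theorem sliceCoercive_inner_of_twoZone (hsub : ∀ y, S₁ y → S₀ y) {c : ℝ}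
    (h2 : SliceCoercive (curlR n M S₀) (gradR₂ n M S₀ S₁) (GOm n M a' S₁) (QOm n M S₁) (Qv₂ n M S₀ S₁) a c) :
    SliceCoercive (curlR n M S₁) (gradR n M S₁) (GOm n M a' S₁) (QOm n M S₁) (avgR n M S₁) (a * (n : ℝ) ^ d) c := by
  intro A₁ hA₁
  have hext := ext_extend n M S₀ S₁ hsub A₁
  -- the embedded field lies on the two-zone slice
  have hsl : gaugeR (GOm n M a' S₁) (QOm n M S₁) *ᵥ ((gradR₂ n M S₀ S₁)ᴴ *ᵥ (fun b : {b // starReg n M S₀ b} => ext (starReg n M S₁) A₁ b.1)) = 0 := by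
    rw [gradR₂_conjTranspose_mulVec_eq_inner n M S₀ S₁ hsub, inner_extend]; exact hA₁
  have h := h2 _ hsl
  -- read every term on the inner field
  have hz : nsq (0 : {b // collar n M S₀ S₁ b} → ℂ) = 0 := by simp [nsq]
  have e0 : nsq (fun b : {b // starReg n M S₀ b} => ext (starReg n M S₁) A₁ b.1) = nsq A₁ := by
    rw [nsq_split n M S₀ S₁ hsub, inner_extend, selC_extend, hz, add_zero]
  have e1 : curlR n M S₀ *ᵥ (fun b : {b // starReg n M S₀ b} => ext (starReg n M S₁) A₁ b.1) = curlR n M S₁ *ᵥ A₁ := by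
    rw [curlR_mulVec, curlR_mulVec, hext]
  have e2 : avgR n M S₀ *ᵥ (fun b : {b // starReg n M S₀ b} => ext (starReg n M S₁) A₁ b.1) = avgR n M S₁ *ᵥ A₁ := by
    rw [avgR_mulVec, avgR_mulVec, hext]
  rw [nsq_Qv₂_mulVec, e0, e1, e2, selC_extend, hz, mul_zero, add_zero] at h
  linarith

/-! ## §4 The single-zone inequality of the inner region implies the two-zone inequality (constants `d`, `a`) -/

/-- the real-arithmetic core of §4 (every product inequality supplied by hand). [folklore] -/
theorem twoZone_arith {a c ε P n2 X Nin Cin Ccol Ctot Qin Qcol Qtot K : ℝ} (ha : 0 ≤ a) (hε0 : 0 ≤ ε) (hP : 0 ≤ P)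
    (hX : 0 ≤ X) (hin : c * Nin ≤ Cin + a * P * Qin) (hc1 : ε / 2 * Cin - ε * Ccol ≤ Ctot)
    (hq1 : ε / 2 * Qin - ε * Qcol ≤ Qtot) (hcc : Ccol ≤ K * X) (hqc : P * Qcol ≤ X) (hεK : ε * (K + a) ≤ a / 2 * n2)
    (hn2X : a / 2 * X ≤ a / 2 * n2 * X) :
    ε / 2 * c * Nin + a / 2 * X ≤ Ctot + a * (P * Qtot + n2 * X) := by
  have i1 : a * P * (ε / 2 * Qin - ε * Qcol) ≤ a * P * Qtot := mul_le_mul_of_nonneg_left hq1 (mul_nonneg ha hP)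
  have i2 : a * ε * (P * Qcol) ≤ a * ε * X := mul_le_mul_of_nonneg_left hqc (mul_nonneg ha hε0)
  have i3 : ε * Ccol ≤ ε * (K * X) := mul_le_mul_of_nonneg_left hcc hε0
  have i4 : ε / 2 * (c * Nin) ≤ ε / 2 * (Cin + a * P * Qin) := mul_le_mul_of_nonneg_left hin (by linarith)
  have i5 : ε * (K + a) * X ≤ a / 2 * n2 * X := mul_le_mul_of_nonneg_right hεK hX
  linarith [i1, i2, i3, i4, i5]

/-- **`SliceCoercive(S₁,c) ⟹ SliceCoercive₂(S₀,S₁, min(a·c/(4(4d+a)), a/2))`** (`0 < a`): split `A = A_in + A_col`; the inner part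
obeys the single-zone inequality (the two-zone slice condition IS the inner one); the collar part's curl costs `≤ 4dn²‖A_col‖²` and its averages
`≤ ‖A_col‖²`, both paid by the collar mass `a n²‖A_col‖²` after weighting by `ε = a/(2(4d+a))`. [folklore] -/
theorem sliceCoercive_twoZone_of_inner (hsub : ∀ y, S₁ y → S₀ y) (ha : 0 < a) {c : ℝ}
    (h1 : SliceCoercive (curlR n M S₁) (gradR n M S₁) (GOm n M a' S₁) (QOm n M S₁) (avgR n M S₁) (a * (n : ℝ) ^ d) c) :
    SliceCoercive (curlR n M S₀) (gradR₂ n M S₀ S₁) (GOm n M a' S₁) (QOm n M S₁) (Qv₂ n M S₀ S₁) a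
      (min (a * c / (4 * (4 * d + a))) (a / 2)) := by
  intro A hA
  have hn1 : (1 : ℝ) ≤ (n : ℝ) := by exact_mod_cast Nat.pos_of_ne_zero (NeZero.ne n)
  have hn2 : (1 : ℝ) ≤ (n : ℝ) ^ 2 := one_le_pow₀ hn1
  have hd : (0 : ℝ) ≤ d := Nat.cast_nonneg d
  have hnd : (0 : ℝ) ≤ (n : ℝ) ^ d := by positivity
  -- the pieces on the torus
  set Bin := ext (starReg n M S₁) (inner n M S₀ S₁ hsub A) with hBin
  set Bcol := ext (collar n M S₀ S₁) (selC n M S₀ S₁ *ᵥ A) with hBcol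
  have hsplit : ext (starReg n M S₀) A = Bin + Bcol := ext_split n M S₀ S₁ hsub A
  set X := nsq (selC n M S₀ S₁ *ᵥ A) with hX
  have hXcol : nsq Bcol = X := nsq_ext _ _
  have hX0 : 0 ≤ X := nsq_nonneg _
  -- the inner field lies on the single-zone slice of Ω₁, so the single-zone inequality applies to it
  have hslice : gaugeR (GOm n M a' S₁) (QOm n M S₁) *ᵥ ((gradR n M S₁)ᴴ *ᵥ inner n M S₀ S₁ hsub A) = 0 := by
    rw [← gradR₂_conjTranspose_mulVec_eq_inner n M S₀ S₁ hsub]; exact hA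
  have hin := h1 (inner n M S₀ S₁ hsub A) hslice
  rw [curlR_mulVec, avgR_mulVec, ← hBin] at hin
  have hnin : nsq (inner n M S₀ S₁ hsub A) = nsq Bin := (nsq_ext _ _).symm
  rw [hnin] at hin
  -- the collar part's curl and averages
  have hcurl_col : nsq ((((Real.sqrt 2)⁻¹ : ℝ) : ℂ) • (CurlOp (fine n M) (n : ℂ) *ᵥ Bcol)) ≤ 4 * d * (n : ℝ) ^ 2 * X := by
    rw [← hXcol]; exact nsq_curl_le n M Bcol
  have havg_col : (n : ℝ) ^ d * nsq (QvOp n M *ᵥ Bcol) ≤ X := by rw [← hXcol]; exact nsq_QvOp_mulVec_le n M Bcol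
  -- the whole field's curl and averages split
  have hcurl : curlR n M S₀ *ᵥ A
      = (((Real.sqrt 2)⁻¹ : ℝ) : ℂ) • (CurlOp (fine n M) (n : ℂ) *ᵥ Bin)
        + (((Real.sqrt 2)⁻¹ : ℝ) : ℂ) • (CurlOp (fine n M) (n : ℂ) *ᵥ Bcol) := by
    rw [curlR_mulVec, hsplit, Matrix.mulVec_add, smul_add]
  have havg : avgR n M S₀ *ᵥ A = QvOp n M *ᵥ Bin + QvOp n M *ᵥ Bcol := by rw [avgR_mulVec, hsplit, Matrix.mulVec_add]
  -- the weight
  set ε := a / (2 * (4 * d + a)) with hε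
  have hε0 : 0 ≤ ε := by positivity
  have hε1 : ε ≤ 1 := by
    rw [hε, div_le_one (by positivity)]; linarith
  have hεK : ε * (4 * d * (n : ℝ) ^ 2 + a) ≤ a / 2 * (n : ℝ) ^ 2 := by
    have h1' : ε * (4 * d * (n : ℝ) ^ 2 + a) ≤ ε * ((4 * d + a) * (n : ℝ) ^ 2) :=
      mul_le_mul_of_nonneg_left (by nlinarith) hε0
    have h2ne : (2 * (4 * (d : ℝ) + a)) ≠ 0 := by positivity
    have h2' : ε * ((4 * d + a) * (n : ℝ) ^ 2) = a / 2 * (n : ℝ) ^ 2 := by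
      rw [hε, div_mul_eq_mul_div, div_eq_iff h2ne]; ring
    linarith
  have hεc : ε / 2 * c = a * c / (4 * (4 * d + a)) := by
    have h2ne : (2 * (4 * (d : ℝ) + a) * 2) ≠ 0 := by positivity
    have h4ne : (4 * (4 * (d : ℝ) + a)) ≠ 0 := by positivity
    rw [hε, div_div, div_mul_eq_mul_div, div_eq_div_iff h2ne h4ne]; ring
  have hn2X : a / 2 * X ≤ a / 2 * (n : ℝ) ^ 2 * X := by
    nlinarith [mul_le_mul_of_nonneg_left hn2 (by positivity : (0:ℝ) ≤ a / 2 * X)]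
  -- lower bounds for the curl and averaging terms of the whole field
  have hc1 := nsq_add_ge ((((Real.sqrt 2)⁻¹ : ℝ) : ℂ) • (CurlOp (fine n M) (n : ℂ) *ᵥ Bin))
    ((((Real.sqrt 2)⁻¹ : ℝ) : ℂ) • (CurlOp (fine n M) (n : ℂ) *ᵥ Bcol)) hε0 hε1
  have hq1 := nsq_add_ge (QvOp n M *ᵥ Bin) (QvOp n M *ᵥ Bcol) hε0 hε1
  rw [← hcurl] at hc1
  rw [← havg] at hq1
  -- assemble
  have hfin := twoZone_arith ha.le hε0 hnd hX0 hin hc1 hq1 hcurl_col havg_col hεK hn2X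
  rw [nsq_Qv₂_mulVec, ← hX, nsq_split n M S₀ S₁ hsub A, ← hX, hnin]
  have hmin1 : min (a * c / (4 * (4 * d + a))) (a / 2) ≤ a * c / (4 * (4 * d + a)) := min_le_left _ _
  have hmin2 : min (a * c / (4 * (4 * d + a))) (a / 2) ≤ a / 2 := min_le_right _ _
  have hBin0 := nsq_nonneg Bin
  calc min (a * c / (4 * (4 * d + a))) (a / 2) * (nsq Bin + X)
      = min (a * c / (4 * (4 * d + a))) (a / 2) * nsq Bin + min (a * c / (4 * (4 * d + a))) (a / 2) * X := mul_add _ _ _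
    _ ≤ a * c / (4 * (4 * d + a)) * nsq Bin + a / 2 * X :=
        add_le_add (mul_le_mul_of_nonneg_right hmin1 hBin0) (mul_le_mul_of_nonneg_right hmin2 hX0)
    _ = ε / 2 * c * nsq Bin + a / 2 * X := by rw [hεc]
    _ ≤ _ := hfin

/-! ## §5 Hence the single-zone slice constant of `S₁` alone bounds `‖G₂(Ω₀)‖` -/

/-- **`‖G₂(Ω₀)‖` FROM THE INNER REGION's SLICE CONSTANT**, uniformly in `S₀ ⊇ S₁`, `n`, `M`. [folklore] -/
theorem opNorm_inv_regionDeltaA₂_le_of_inner (hsub : ∀ y, S₁ y → S₀ y) (ha : 0 < a) (ha' : 0 < a') {c : ℝ} (hc : 0 < c)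
    (h1 : SliceCoercive (curlR n M S₁) (gradR n M S₁) (GOm n M a' S₁) (QOm n M S₁) (avgR n M S₁) (a * (n : ℝ) ^ d) c) :
    ‖(regionDeltaA₂ n M a a' S₀ S₁)⁻¹‖
      ≤ (min (min (a * c / (4 * (4 * d + a))) (a / 2) / 2) (1 / (2 * (gammaPs d a')⁻¹)))⁻¹ :=
  opNorm_inv_regionDeltaA₂_le_of_slice n M a a' S₀ S₁ hsub ha' (lt_min (by positivity) (by positivity))
    (sliceCoercive_twoZone_of_inner n M a a' S₀ S₁ hsub ha h1)

end Split

end Summit.QuantumFields.BalabanUV.T4Continuum.RegionGaugeTwoZoneTransfer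

end
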